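import Mathlib.Analysis.Complex.ExponentialBounds
import Literature.MathematicalPhysics.QuantumFieldTheory.Balaban1983to89.B4Eq19LatticeOperators
import HarnessLib

/-!
# Line «poincare_lipschitz» on crux `HistoryTailL` (stmt-QuantumFields-19936), K2 FINAL KNIT `hRegH_of_hImprove` — K-2 §3 «LADDER LETTERS»: the integer∕real
# bookkeeping by which the flat end-game (LEAD ym-ust-19936-w1 g9's K-2 `…KnitFlatEndgame`) places the F6-S ladder top `m^K` inside hImprove's good box `Q_{2r}(z)`

Cell `ym3-torus` (YM ladder rung R3 = continuum SU(2) Yang–Mills on the three-torus — a RUNG, NOT the Clay problem: not d = 4, not infinite volume, not a mass gap);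
width seat `ym3-torus-px8` gen 5 (LEAD ★w1-19936 g9 2026-08-29 06:49:23Z «px8 g5: K-2 §3 LADDER LETTERS … say MINE» — MINE 06:52Z).  THEOREMS ONLY (def-free), pure
`ℤ`∕`ℝ` and lit ✓`B4Eq19LatticeOperators.box`; `--supports stmt-QuantumFields-19936 --as helper`.  NOTHING of `hC`, K-2, `hImprove`, `hRegH`, a stub, `BlockLipschitzL`,
`HistoryTailL` or a summit statement is proved here.

* §1 ★ `exists_ladder_top` — for an integer ratio `m ≥ 2` and `N ≥ 1` there is `K` with `N∕m < m^K ≤ N` (`K := Nat.log m N`): the F6-S ladder top below hImprove's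
  `2r − 1`, within a factor `m`; ★ `exists_ladder_top'` — at `N := 2r − 1 ≥ m`: additionally `1 ≤ K` and `2 ≤ m^K` (the door's `2ρ₀ ≤ m^K` at `ρ₀ = 1`).  `le_mul_of_ladder_top` — the companion reading `N < m·m^K`.
* §2 ★ `box_subset_box_of_mem_box_one` — `x ∈ Q_1(z)`, `ρ + 1 ≤ R′` ⟹ `Q_ρ(x) ⊆ Q_{R′}(z)` (so `Q_{m^K}(x) ⊆ Q_{2r}(z)` for the centres `x ∈ Q_1(z)` the knit reads at
  unit radius, from `m^K ≤ 2r − 1`); `box_subset_box_of_mem_box` — general `x ∈ Q_a(z)`, `ρ + a ≤ R′`.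
* §3 ★ `one_add_log_two_mul_pow_six_le` — `(1 + log(2r))⁶ ≤ 64·(log r)⁶` for real `r ≥ 8` (`1 + log 2 ≤ log 8 ≤ log r`, Mathlib `Real.log_two_lt_d9`); `one_add_log_le_two_mul_log`.
* §4 `card_box_three` — `#Q_ρ(z) = (2ρ+1)³` on `ℤ³` as a real (lit ✓`card_box`); `pow_three_le_27`, `three_mul_pow_three_le_375` — `(2r+1)³ ≤ 27r³`, `3(2r+3)³ ≤ 375r³`
  (`r ≥ 1`; w2 g12's `N_r` arithmetic).
[folklore]
-/

set_option autoImplicit false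

noncomputable section

open scoped BigOperators
open Finset

namespace Summit.QuantumFields.YangMills.Theorems.PoincareLipschitzKnitLadderLetters

open Literature.MathematicalPhysics.QuantumFieldTheory.Balaban1983to89
open B4Eq19LatticeOperators

/-! ## §1 The ladder top -/

/-- ★ **THE LADDER TOP.**  `m ≥ 2`, `N ≥ 1` ⟹ `∃ K, N∕m < m^K ∧ m^K ≤ N` (take `K := Nat.log m N`). [folklore] -/
theorem exists_ladder_top {m : ℕ} (hm : 2 ≤ m) {N : ℤ} (hN : 1 ≤ N) :
    ∃ K : ℕ, (N : ℝ) / m < (m : ℝ) ^ K ∧ (m : ℤ) ^ K ≤ N := by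
  obtain ⟨n, rfl⟩ : ∃ n : ℕ, N = (n : ℤ) := ⟨N.toNat, (Int.toNat_of_nonneg (by omega)).symm⟩
  have hn0 : n ≠ 0 := by
    intro h; subst h; simp at hN
  refine ⟨Nat.log m n, ?_, ?_⟩
  · have hlt : n < m ^ (Nat.log m n).succ := Nat.lt_pow_succ_log_self (by omega) n
    have hm0 : (0 : ℝ) < m := by exact_mod_cast (by omega : 0 < m)
    rw [div_lt_iff₀ hm0]
    have : (n : ℝ) < (m : ℝ) ^ (Nat.log m n + 1) := by exact_mod_cast hlt
    rw [pow_succ] at this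
    push_cast
    linarith
  · have hle : m ^ Nat.log m n ≤ n := Nat.pow_log_le_self m hn0
    exact_mod_cast hle

/-- ★ **THE LADDER TOP AT `N := 2r − 1`, WITH `K ≥ 1`** (LEAD ★w1-19936 g9's re-cut: the door's `2ρ₀ ≤ m^K` at `ρ₀ = 1` wants `2 ≤ m^K`).  If `m ≥ 2` and `m ≤ 2r − 1`
then `∃ K ≥ 1` with `(2r−1)∕m < m^K ≤ 2r − 1` and `2 ≤ m^K`. [folklore] -/
theorem exists_ladder_top' {m : ℕ} (hm : 2 ≤ m) {r : ℤ} (hr : (m : ℤ) ≤ 2 * r - 1) :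
    ∃ K : ℕ, 1 ≤ K ∧ (((2 * r - 1 : ℤ)) : ℝ) / m < (m : ℝ) ^ K ∧ (m : ℤ) ^ K ≤ 2 * r - 1 ∧ 2 ≤ (m : ℤ) ^ K := by
  have hm2 : (2 : ℤ) ≤ m := by exact_mod_cast hm
  have hN : (1 : ℤ) ≤ 2 * r - 1 := by linarith
  obtain ⟨K, h1, h2⟩ := exists_ladder_top hm hN
  have hm0 : (0 : ℝ) < m := by exact_mod_cast (by omega : 0 < m)
  have hK : 1 ≤ K := by
    by_contra hK0
    have hK0' : K = 0 := by omega
    rw [hK0', pow_zero, div_lt_one hm0] at h1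
    have : ((m : ℤ) : ℝ) ≤ ((2 * r - 1 : ℤ) : ℝ) := by exact_mod_cast hr
    push_cast at this h1
    linarith
  refine ⟨K, hK, h1, h2, ?_⟩
  calc (2 : ℤ) ≤ m := by exact_mod_cast hm
    _ = (m : ℤ) ^ 1 := (pow_one _).symm
    _ ≤ (m : ℤ) ^ K := pow_le_pow_right₀ (by exact_mod_cast (by omega : 1 ≤ m)) hK

/-- The companion reading of the ladder top: `N < m·m^K`. [folklore] -/
theorem lt_mul_of_ladder_top {m : ℕ} (hm : 2 ≤ m) {N : ℤ} {K : ℕ} (h : (N : ℝ) / m < (m : ℝ) ^ K) : (N : ℝ) < m * (m : ℝ) ^ K := by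
  have hm0 : (0 : ℝ) < m := by exact_mod_cast (by omega : 0 < m)
  rw [div_lt_iff₀ hm0] at h
  linarith

/-! ## §2 Boxes around the unit-radius centres -/

/-- **RE-CENTRING A BOX.**  `x ∈ Q_a(z)` and `ρ + a ≤ R′` ⟹ `Q_ρ(x) ⊆ Q_{R′}(z)`. [folklore] -/
theorem box_subset_box_of_mem_box {d : ℕ} {z x : Zd d} {a ρ R' : ℤ} (hx : x ∈ box z a) (h : ρ + a ≤ R') : box x ρ ⊆ box z R' := by
  refine box_subset_box fun i => ?_
  have := (mem_box.1 hx) i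
  linarith

/-- ★ **THE UNIT-RADIUS CENTRES SEE THE GOOD BOX.**  `x ∈ Q_1(z)` and `ρ + 1 ≤ R′` ⟹ `Q_ρ(x) ⊆ Q_{R′}(z)`; in the knit: `ρ := m^K ≤ 2r − 1`, `R′ := 2r`.
[folklore] -/
theorem box_subset_box_of_mem_box_one {d : ℕ} {z x : Zd d} {ρ R' : ℤ} (hx : x ∈ box z 1) (h : ρ + 1 ≤ R') : box x ρ ⊆ box z R' :=
  box_subset_box_of_mem_box hx h

/-- The knit's instance: `x ∈ Q_1(z)`, `m^K ≤ 2r − 1` ⟹ `Q_{m^K}(x) ⊆ Q_{2r}(z)`. [folklore] -/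
theorem box_ladderTop_subset {d : ℕ} {z x : Zd d} {m : ℕ} {K : ℕ} {r : ℤ} (hx : x ∈ box z 1) (hK : (m : ℤ) ^ K ≤ 2 * r - 1) :
    box x ((m : ℤ) ^ K) ⊆ box z (2 * r) :=
  box_subset_box_of_mem_box_one hx (by linarith)

/-! ## §3 The threshold's logarithm at the doubled radius -/

/-- `1 + log(2r) ≤ 2·log r` for real `r ≥ 8` (since `1 + log 2 < 1.7 < 3·0.69 < log 8 ≤ log r`). [folklore] -/
theorem one_add_log_le_two_mul_log {r : ℝ} (hr : 8 ≤ r) : 1 + Real.log (2 * r) ≤ 2 * Real.log r := by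
  have hr0 : 0 < r := by linarith
  have hlog2 := Real.log_two_lt_d9
  have hlog2' := Real.log_two_gt_d9
  have h8 : Real.log 8 ≤ Real.log r := Real.log_le_log (by norm_num) hr
  have hlog8 : Real.log 8 = 3 * Real.log 2 := by
    rw [show (8 : ℝ) = 2 ^ 3 by norm_num, Real.log_pow]; norm_num
  rw [Real.log_mul (by norm_num) hr0.ne']
  linarith

/-- ★ **`(1 + log(2r))⁶ ≤ 64·(log r)⁶`** for real `r ≥ 8` — hImprove's smallness at `Q_{2r}` read in the `(1 + log ·)⁶` threshold of the door. [folklore] -/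
theorem one_add_log_two_mul_pow_six_le {r : ℝ} (hr : 8 ≤ r) : (1 + Real.log (2 * r)) ^ 6 ≤ 64 * Real.log r ^ 6 := by
  have h := one_add_log_le_two_mul_log hr
  have h0 : 0 ≤ 1 + Real.log (2 * r) := by
    have : 0 ≤ Real.log (2 * r) := Real.log_nonneg (by linarith)
    linarith
  calc (1 + Real.log (2 * r)) ^ 6 ≤ (2 * Real.log r) ^ 6 := pow_le_pow_left₀ h0 h 6
    _ = 64 * Real.log r ^ 6 := by ring

/-! ## §4 Box cardinalities on `ℤ³` -/

/-- `#Q_ρ(z) = (2ρ+1)³` on `ℤ³`, as a real. [folklore] -/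
theorem card_box_three (z : Zd 3) {ρ : ℤ} (hρ : 0 ≤ ρ) : ((box z ρ).card : ℝ) = (2 * (ρ : ℝ) + 1) ^ 3 := by
  rw [card_box z hρ]; push_cast; ring

/-- `(2r+1)³ ≤ 27·r³` for real `r ≥ 1`. [folklore] -/
theorem pow_three_le_27 {r : ℝ} (hr : 1 ≤ r) : (2 * r + 1) ^ 3 ≤ 27 * r ^ 3 := by
  have h : 2 * r + 1 ≤ 3 * r := by linarith
  calc (2 * r + 1) ^ 3 ≤ (3 * r) ^ 3 := pow_le_pow_left₀ (by linarith) h 3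
    _ = 27 * r ^ 3 := by ring

/-- `3·(2r+3)³ ≤ 375·r³` for real `r ≥ 1` (the bond count `N_r = 3·#Q_{r+1}(z)` on `ℤ³`). [folklore] -/
theorem three_mul_pow_three_le_375 {r : ℝ} (hr : 1 ≤ r) : 3 * (2 * r + 3) ^ 3 ≤ 375 * r ^ 3 := by
  have h : 2 * r + 3 ≤ 5 * r := by linarith
  calc 3 * (2 * r + 3) ^ 3 ≤ 3 * (5 * r) ^ 3 := by
        have := pow_le_pow_left₀ (by linarith : (0 : ℝ) ≤ 2 * r + 3) h 3; linarith
    _ = 375 * r ^ 3 := by ring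

/-- The bond count of `Q_{r+1}(z)` on `ℤ³`: `3·#Q_{r+1}(z) = 3(2r+3)³ ≤ 375·r³` for `r ≥ 1`. [folklore] -/
theorem three_mul_card_box_succ_le (z : Zd 3) {r : ℤ} (hr : 1 ≤ r) : 3 * ((box z (r + 1)).card : ℝ) ≤ 375 * (r : ℝ) ^ 3 := by
  rw [card_box z (by omega)]
  push_cast
  have hr' : (1 : ℝ) ≤ r := by exact_mod_cast hr
  have := three_mul_pow_three_le_375 hr'
  calc (3 : ℝ) * (2 * ((r : ℝ) + 1) + 1) ^ 3 = 3 * (2 * r + 3) ^ 3 := by ring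
    _ ≤ 375 * (r : ℝ) ^ 3 := this

end Summit.QuantumFields.YangMills.Theorems.PoincareLipschitzKnitLadderLetters

end
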